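import Summits.NavierStokesRegularity.NavierStokesRegularity.Theorems.ClockStretchingLawSteadySliceLiouville
import Literature.Analysis.FluidPDE.KNSSOseenMildDecayTools
import HarnessLib

/-!
# Route ClockStretchingLaw — crux `ClockCeiling`, stub `stub_shearRigidity`

Line `registered` of crux `ClockCeiling` (stmt-NavierStokesRegularity-10570), the first half of
the `c₀ = 0` alternative of frame rigidity: **a shear-free instant propagates to all times**.
If an element `u` of the route's Type-I class has one slice with vanishing directional
derivative, `∂_b u(t₀, ·) ≡ 0` (`t₀ < 0`), then `u(t, x + h b) = u(t, x)` for ALL `t < 0`, `x`, `h`.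

## Proof

1. *The slice.* `r ↦ u(t₀, x + r b)` has derivative `∂_b u(t₀, x + r b) = 0`, hence is constant:
   `u(t₀, · + h b) = u(t₀, ·)`.
2. *Forward* (`t₀ < t < 0`). `u` and its space translate `v = u(·, · + h b)` both solve the Oseen
   integral equation from time `t₀` with the SAME free term `e^{(t-t₀)Δ}u(t₀)` (translation
   covariance of the caloric extension, `heatExtension_comp_add_right`, of the Duhamel term,
   `oseenDuhamel_comp_add_right`, and step 1); both are bounded by `C/√(-T)` on `(t₀, T)`,
   `T = t/2 < 0`, so they agree by the uniqueness of bounded Oseen-mild solutions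
   (`oseenMild_bounded_unique`, KNSS 2009 §4) and continuity of slices.
3. *Backward.* `uncurry u` is jointly real-analytic on `(-∞,0) × ℝ³`
   (`analyticOnNhd_uncurry_of_oseenMild`); the analytic curve `s ↦ u(s, x + h b) - u(s, x)`
   vanishes on `(t₀, 0)`, hence on `(-∞, 0)` by the identity theorem.

## References

* G. Koch, N. Nadirashvili, G. Seregin, V. Šverák, Acta Math. 203 (2009) = arXiv:0709.3599, §4.
* P. G. Lemarié-Rieusset, *The Navier–Stokes Problem in the 21st Century*, CRC Press 2016,
  Thm. 9.12.
-/

set_option linter.dupNamespace false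

noncomputable section

open Literature.Analysis.FluidPDE MeasureTheory Set Function Filter Topology
open Literature.Analysis.UnboundedOperators (heatExtension heatKernel)
open scoped ENNReal NNReal

namespace Summit.NavierStokesRegularity.NavierStokesRegularity.Theorems

section ShearRigidity

variable {C : ℝ} {u : ℝ → (EuclideanSpace ℝ (Fin 3)) → (EuclideanSpace ℝ (Fin 3))}

/-- Slices `u t`, `t < 0`, of a field jointly smooth on `(-∞, 0) × ℝ³` are smooth.

Deprecated duplicate (dedup-03063): this is
`Literature.Analysis.FluidPDE.IsSmoothSpaceTimeOn.contDiff_slice` (`ClassicalSolution.lean`) with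
`S := Iio 0` (`IsSmoothSpaceTimeOn S u` unfolds to the hypothesis `hsm`); use that lemma. -/
@[deprecated IsSmoothSpaceTimeOn.contDiff_slice (since := "2026-08-17")]
theorem shearRigidity_contDiff_slice (hsm : ContDiffOn ℝ (⊤ : ℕ∞) (uncurry u) (Iio 0 ×ˢ univ))
    {t : ℝ} (ht : t < 0) : ContDiff ℝ (⊤ : ℕ∞) (u t) :=
  IsSmoothSpaceTimeOn.contDiff_slice hsm ht

/-- **Step 1 — the shear-free slice is translation invariant**: if `∂_b f ≡ 0` for the smooth
slice `f = u t₀` then `f(x + h b) = f(x)` (the curve `r ↦ f(x + r b)` has zero derivative). -/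
theorem shearRigidity_slice_const (hsm : ContDiffOn ℝ (⊤ : ℕ∞) (uncurry u) (Iio 0 ×ˢ univ))
    {t₀ : ℝ} (ht₀ : t₀ < 0) {b : EuclideanSpace ℝ (Fin 3)} (hb : ∀ x, fderiv ℝ (u t₀) x b = 0)
    (x : EuclideanSpace ℝ (Fin 3)) (h : ℝ) : u t₀ (x + h • b) = u t₀ x := by
  have hd : Differentiable ℝ (u t₀) :=
    (IsSmoothSpaceTimeOn.contDiff_slice hsm ht₀).differentiable (by simp)
  have hline : ∀ r : ℝ, HasDerivAt (fun r : ℝ => x + r • b) b r := fun r => by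
    simpa using ((hasDerivAt_id r).smul_const b).const_add x
  have hφ : ∀ r : ℝ, HasDerivAt (fun r : ℝ => u t₀ (x + r • b)) (fderiv ℝ (u t₀) (x + r • b) b) r :=
    fun r => (hd (x + r • b)).hasFDerivAt.comp_hasDerivAt r (hline r)
  have hdiff : Differentiable ℝ (fun r : ℝ => u t₀ (x + r • b)) := fun r => (hφ r).differentiableAt
  have hder : ∀ r, deriv (fun r : ℝ => u t₀ (x + r • b)) r = 0 := fun r => by
    rw [(hφ r).deriv, hb]
  simpa using is_const_of_deriv_eq_zero hdiff hder h 0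

/-- **Step 2 — forward propagation by uniqueness**: if the slice `u t₀` is invariant under the
translation by `a`, so is every later slice `u t`, `t₀ < t < 0`: `u` and `u(·, · + a)` solve the
Oseen integral equation from `t₀` with the same free term `e^{(t-t₀)Δ}u(t₀)` and are bounded on
`(t₀, t/2) × ℝ³`, hence coincide (KNSS 2009, §4: uniqueness of bounded mild solutions). -/
theorem shearRigidity_forward (hsm : ContDiffOn ℝ (⊤ : ℕ∞) (uncurry u) (Iio 0 ×ˢ univ))
    (hmildO : ∀ s t : ℝ, s < t → t < 0 → ∀ x,
      u t x = heatExtension (u s) (t - s) x - oseenDuhamel 1 s u u t x)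
    (hTI : HasTypeITimeDecay C u) {t₀ : ℝ} {a : EuclideanSpace ℝ (Fin 3)}
    (hslice : ∀ x, u t₀ (x + a) = u t₀ x) {t : ℝ} (ht₀t : t₀ < t) (ht : t < 0)
    (x : EuclideanSpace ℝ (Fin 3)) : u t (x + a) = u t x := by
  have hC : 0 ≤ C := steadySlice_typeI_const_nonneg hTI
  have hcont : ContinuousOn (uncurry u) (Iio 0 ×ˢ univ) := hsm.continuousOn
  -- comparison interval `(t₀, T)`, `T = t/2`, bound `M = C/√(-T)`
  set T : ℝ := t / 2 with hT
  have htT : t < T := by rw [hT]; linarith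
  have hT0 : T < 0 := by rw [hT]; linarith
  set M : ℝ := C / Real.sqrt (-T) with hM
  have hM0 : 0 ≤ M := div_nonneg hC (Real.sqrt_nonneg _)
  have hbdM : ∀ τ ∈ Ioo t₀ T, ∀ y, ‖u τ y‖ ≤ M := fun τ hτ y =>
    steadySlice_norm_le_of_hasTypeITimeDecay hTI hC hT0 hτ.2.le y
  have hslice_fun : (fun y => u t₀ (y + a)) = u t₀ := funext hslice
  -- joint measurability of `u` and of its space translate on the slab
  have hum : AEStronglyMeasurable (uncurry u)
      ((volume : Measure (ℝ × EuclideanSpace ℝ (Fin 3))).restrict (Ioo t₀ T ×ˢ univ)) :=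
    (hcont.mono (prod_mono (fun τ hτ => (hτ.2.trans hT0 : τ < 0)) Subset.rfl)).aestronglyMeasurable
      (measurableSet_Ioo.prod MeasurableSet.univ)
  have hvm : AEStronglyMeasurable (uncurry fun τ y => u τ (y + a))
      ((volume : Measure (ℝ × EuclideanSpace ℝ (Fin 3))).restrict (Ioo t₀ T ×ˢ univ)) := by
    have hφ : Continuous fun p : ℝ × EuclideanSpace ℝ (Fin 3) => (p.1, p.2 + a) := by fun_prop
    have hmaps : MapsTo (fun p : ℝ × EuclideanSpace ℝ (Fin 3) => (p.1, p.2 + a))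
        (Ioo t₀ T ×ˢ univ) (Iio 0 ×ˢ univ) := by
      intro p hp
      obtain ⟨hp1, -⟩ := mem_prod.1 hp
      exact mk_mem_prod (hp1.2.trans hT0 : p.1 < 0) (mem_univ _)
    exact (hcont.comp hφ.continuousOn hmaps).aestronglyMeasurable
      (measurableSet_Ioo.prod MeasurableSet.univ)
  -- uniqueness of bounded solutions of the Oseen integral equation on `(t₀, T)`
  have huniq : ∀ t' ∈ Ioo t₀ T, u t' =ᵐ[volume] (fun τ y => u τ (y + a)) t' :=
    oseenMild_bounded_unique (ν := 1) (s := t₀) (T := T) (M := M) (u := u)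
      (v := fun τ y => u τ (y + a)) (U := fun t x => heatExtension (u t₀) (t - t₀) x)
      one_pos hM0 hum hvm hbdM (fun τ hτ y => hbdM τ hτ (y + a))
      (fun t ht => Eventually.of_forall (hmildO t₀ t ht.1 (ht.2.trans hT0)))
      (fun t ht => Eventually.of_forall fun x => by
        show u t (x + a) = heatExtension (u t₀) (t - t₀) x -
          oseenDuhamel 1 t₀ (fun τ y => u τ (y + a)) (fun τ y => u τ (y + a)) t x
        rw [oseenDuhamel_comp_add_right, hmildO t₀ t ht.1 (ht.2.trans hT0) (x + a),
          ← heatExtension_comp_add_right (u t₀) a (t - t₀) x, hslice_fun])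
  have hcu : Continuous (u t) := steadySlice_continuous_slice hsm ht
  have hcv : Continuous fun y => u t (y + a) := hcu.comp (continuous_id.add continuous_const)
  have heq : u t = fun y => u t (y + a) :=
    (Continuous.ae_eq_iff_eq volume hcu hcv).1 (huniq t ⟨ht₀t, htT⟩)
  exact (congrFun heq x).symm

end ShearRigidity

/-- **Stub `stub_shearRigidity` — a shear-free instant propagates to all times**: for an element
`u` of the Type-I class of route `ClockStretchingLaw`, `∂_b u(t₀,·) ≡ 0` at one `t₀ < 0` implies
`u(t, x + hb) = u(t, x)` for all `t < 0`. Forward in time by the uniqueness of bounded solutions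
of the Oseen integral equation (`shearRigidity_forward`, KNSS 2009 §4), backward by the joint
real analyticity of `u` on `(-∞,0) × ℝ³` (`analyticOnNhd_uncurry_of_oseenMild`, Lemarié-Rieusset
2016 Thm. 9.12) and the identity theorem for the analytic curve `s ↦ u(s, x + hb) - u(s, x)`,
which vanishes on `(t₀, 0)`. [cite: KochNadirashviliSereginSverak2009, §4 p. 8 (arXiv:0709.3599)] -/
theorem stub_shearRigidity :
    ∀ (C : ℝ) (u : ℝ → EuclideanSpace ℝ (Fin 3) → EuclideanSpace ℝ (Fin 3)), ContDiffOn ℝ (⊤ : ℕ∞) (Function.uncurry u) (Set.Iio 0 ×ˢ Set.univ) ∧ (∀ t < 0, Literature.Analysis.FluidPDE.VectorCalculus.IsDivFree (u t)) ∧ (∀ s t : ℝ, s < t → t < 0 → ∀ x, u t x = Literature.Analysis.FluidPDE.heatFlow (u s) (t - s) x - ∫ τ in Set.Ioo s t, ∫ y, ((-(inner ℝ (x - y) (u τ y) / (2 * (t - τ)) * Literature.Analysis.UnboundedOperators.heatKernel (t - τ) (x - y))) • u τ y + (∫ σ in Set.Ioi (t - τ), Literature.Analysis.UnboundedOperators.heatKernel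 σ (x - y) / (4 * σ ^ 2)) • (inner ℝ (x - y) (u τ y) • u τ y + inner ℝ (u τ y) (u τ y) • (x - y) + inner ℝ (x - y) (u τ y) • u τ y) - ((∫ σ in Set.Ioi (t - τ), Literature.Analysis.UnboundedOperators.heatKernel σ (x - y) / (8 * σ ^ 3)) * (inner ℝ (x - y) (u τ y) * inner ℝ (x - y) (u τ y))) • (x - y))) ∧ Literature.Analysis.FluidPDE.HasTypeITimeDecay C u ∧ (∀ (x₀ : EuclideanSpace ℝ (Fin 3)) (t₀ r : ℝ), t₀ ≤ 0 → 0 < r → (∀ t, t₀ - r ^ 2 < t → t < t₀ → r⁻¹ * ∫ x in Metric.ball x₀ r, ‖u t x‖ ^ 2 ≤ C) ∧ r⁻¹ * ∫ t in Set.Ioo (t₀ - r ^ 2) t₀, ∫ x in Metric.ball x₀ r, ‖fderiv ℝ (u t) x‖ ^ 2 ≤ C) → ∀ t₀ : ℝ, t₀ < 0 → ∀ b : EuclideanSpace ℝ (Fin 3), (∀ x, fderiv ℝ (u t₀) x b = 0) → ∀ t : ℝ, t < 0 → ∀ (x : EuclideanSpace ℝ (Fin 3)) (h : ℝ), u t (x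 + h • b) = u t x := by
  intro C u hu t₀ ht₀ b hb t ht x h
  obtain ⟨hsm, -, hmild, hTI, -⟩ := hu
  -- the KNSS-mild clause in the Oseen architecture
  have hmildO : ∀ s t : ℝ, s < t → t < 0 → ∀ x,
      u t x = heatExtension (u s) (t - s) x - oseenDuhamel 1 s u u t x := by
    intro s t hst ht x
    rw [oseenDuhamel_one_eq_unfolded, ← heatFlow_of_pos (u s) (sub_pos.2 hst)]
    exact hmild s t hst ht x
  -- Step 1: the slice `u t₀` is invariant under `· + h • b`
  have hslice : ∀ y, u t₀ (y + h • b) = u t₀ y := fun y =>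
    shearRigidity_slice_const hsm ht₀ hb y h
  -- Step 2: so is every slice `u s`, `t₀ < s < 0`
  have hfwd : ∀ s ∈ Ioo t₀ 0, ∀ y, u s (y + h • b) = u s y := fun s hs y =>
    shearRigidity_forward hsm hmildO hTI hslice hs.1 hs.2 y
  -- Step 3: identity theorem along the analytic time curves
  have han := analyticOnNhd_uncurry_of_oseenMild hsm hmildO hTI
  have hF : AnalyticOnNhd ℝ (fun s => u s (x + h • b)) (Iio 0) := fun s hs =>
    (han (s, x + h • b) (mk_mem_prod hs (mem_univ _))).curry_left
  have hG : AnalyticOnNhd ℝ (fun s => u s x) (Iio 0) := fun s hs =>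
    (han (s, x) (mk_mem_prod hs (mem_univ _))).curry_left
  have heq : (fun s => u s (x + h • b)) =ᶠ[𝓝 (t₀ / 2)] fun s => u s x := by
    have hmem : Ioo t₀ 0 ∈ 𝓝 (t₀ / 2) := Ioo_mem_nhds (by linarith) (by linarith)
    filter_upwards [hmem] with s hs using hfwd s hs x
  have hz₀ : t₀ / 2 ∈ Iio (0 : ℝ) := by
    show t₀ / 2 < 0
    linarith
  exact hF.eqOn_of_preconnected_of_eventuallyEq hG isPreconnected_Iio hz₀ heq ht

end Summit.NavierStokesRegularity.NavierStokesRegularity.Theorems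

end
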